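import Summits.QuantumFields.YangMills.Theorems.AllWindowsColdBoxBoxHighLineOrbitMapBulkSurjAssembly
import Summits.QuantumFields.YangMills.Theorems.AllWindowsColdBoxBoxHighLineOrbitMapContraction
import Summits.QuantumFields.YangMills.Theorems.AllWindowsColdBoxBoxHighLineSmearedFPOrbitJacobian

/-!
# T-S5.4J brick J4 `OrbitMapBulkSurj` BY NAME
# (LINE-19 S5 ⟨stmt-QuantumFields-24004⟩/⟨24335⟩, LINE-20 U5 ⟨24336⟩; task `Cruxes/BoxWindowHighSU2213/TaskS5Laplace.lean`, planner ym-idea-2 g18)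

Width seat `ym-line-sfw-p2-w4` (prover-ym-line-sfw-p2-w4-g27-0), J4 holder.  The conditional brick ✓`orbitMapBulkSurj_of_J1_J2` (Newton–contraction on the
block box, `…OrbitMapBulkSurj` + `…FPOperatorInverseRows` + `…OrbitMapBulkSurjAssembly`) fed with the landed bricks J1 ✓`OrbitChart.orbitMapJacobianDet` (w3,
`…SmearedFPOrbitJacobian`) and J2 ✓`orbitMapContraction` (w2, `…OrbitMapContraction`): **`orbitMapBulkSurj : OrbitMapBulkSurj`**, unconditionally.

Everything proved; no definitions; standard axioms.  HONEST LABEL: ONE brick (J4) of step (1b)/(1c) of the XL stubs S5/U5 of critic-PASSed DRAFT lines on the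
R2ξ″ cruxes; T-S5.4J's assembly (fcl-p3), S5, U5 and the items ⟨24004⟩ ⟨24335⟩ ⟨24336⟩ remain OPEN; no registered stub is closed by name here, no crux, rung
or summit is proved; the Yang–Mills mass gap is NOT proved by this file.
-/

set_option autoImplicit false

namespace Summit.QuantumFields.YangMills.Theorems.AllWindowsColdBoxBoxHighLine

/-- **J4 `OrbitMapBulkSurj`**: every `c` in the `ρ`-ball is `Ψ_V(v)` for some `v` in the `a`-block box (regime `C(r₀+a)H² ≤ 1`, `C·H⁴·a ≤ 1`,
`C(1+log H)²ρ ≤ a`, `V` Landau with links within `r₀²`). -/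
theorem orbitMapBulkSurj : OrbitMapBulkSurj :=
  orbitMapBulkSurj_of_J1_J2 OrbitChart.orbitMapJacobianDet orbitMapContraction

end Summit.QuantumFields.YangMills.Theorems.AllWindowsColdBoxBoxHighLine
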